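import Summits.QuantumFields.BalabanUV.T4Continuum.Support.ShellMeasureAverageIterateRegular
import Literature.MathematicalPhysics.QuantumFieldTheory.Balaban1983to89.B7Prop2SpecialUnitary

/-!
# `T4Continuum.ShellMeasureAverageIterateRegularSUN` — row S59 file 2: [B7] PROPOSITION 2 IN THE b12 TYPING FOR A GAUGE
# GROUP CLOSED UNDER THE AVERAGE AT RADIUS `t` (`B7Prop2SpecialUnitary.AvgClosedAt`), and the printed case
# «a Lie subgroup `G` of a unitary group `U(N)`» with `G = SU(N)`: the averaged backgrounds `Ū₀ʲ`, `j ≤ k`, are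
# `SU(N)`-VALUED, plaquette- and loop-regular from print's (52) alone — for `N ≤ 100` (so for NE7c's certified instance
# `SU(2)`) with NO smallness beyond «`α₀ ≤ c₂`», in general under b07's one `N`-dependent smallness `N·32(d+1)(d+4)L²α₀ < π`
(cell `pub-balaban`, sub-cell `t4`, spine estimate NE7c (node U5b); NE7c ROUND-2 crew `t4-ne7c-formalise-*`, unit
`b2b-balaban-t4-ne7c-formalise-leaf-04` gen 4; owner table `LEAVES-NE7c-P1.md` row **S59** file 2 (file 1 =
`ShellMeasureAverageIterateRegular` p219864, the `AvgClosed` ∕ `U(N)` case); this lineage's c5-optional `SU(N)` orbit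
(rows S3∕S39∕S43, `ShellMeasure*SUN`); ADDITIVE — imports file 1 and b07's `B7Prop2SpecialUnitary` BY NAME, modifies
nothing; 0 `def`, 0 `def … : Prop`, 0 sorry)

HONEST FRAMING.  Finite four-torus programme, rung (B)+1 only — NOT infinite volume, NOT a mass gap, NOT the Clay
problem, NOT summit progress; (B), `BetaPertHyp`, (B^μ) are not consumed.  NE7c (`T4IndicatorShell.ShellWeightBound`) is
NOT PRINTED and NOT PROVED; «NE7c ⇐ the named binders».  As in file 1, NOTHING of the manuscript is asserted: b07's
kernel-checked Proposition 2 at radius `t` (`B7Prop2SpecialUnitary.avgIter_mem_at` ∕ `ineq53_explicit_at`, and its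
`SU(N)` instance `avgClosedAt_specialUnitary` — with b07's FINDING that `SU(N)`-closure of the average needs the
`N`-dependent radius `Nt < π` and FAILS at the `N`-independent one, `not_avgClosed_specialUnitary`) is consumed BY NAME
through file 1's dictionary `avgM_gammaT_eq_bavg`; every `[cite: …]` tag marks the TEXT LOCATION of the object typed.
HONEST DEPENDENCY (cell): continuum YM on T⁴ ⇐ BetaPertH ∧ nine spine estimates (0/9 proved); BetaPertH ⇐ (D1) ∧ (D4) ∧
CAP+tail; G-an2-4 gates asym, D1 and NE2/3/4.

WHAT IS PROVED (kernel, no `sorry`).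
* §1 AT RADIUS `t` (binders: `2 ≤ L`, `hG : AvgClosedAt d t L G`, `hU : ∀ b, U b ∈ G`, `0 < α₀`, `C₀(d)α₀ ≤ ⅓`,
  `2α₀ ≤ c₂′(d,L)`, `32(d+1)(d+4)L²α₀ ≤ t`, (52) `pdev (curry U) < α₀(Lᵏ)⁻²` — exactly b07's `prop2_explicit_at`): for
  every `j ≤ k`, the radius-`t` twins of file 1's §2–§3 family (`mem_level_at`, `norm_level_le_one_at`,
  `norm_level_inv_le_one_at`, `pdev_level_lt_at` (`< 2α₀(Lʲ∕Lᵏ)²`), `plaquette_level_le_at`, `loop_level_le_at`,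
  `loop_level_le_const_at` (`≤ 1∕32`), `avgIter_regular_at`, `analyticOnNhd_Qtilde_level_at`, `norm_Qtilde_level_le_at`) —
  PRIVATE (their conclusions coincide with file 1's token for token, only the group hypothesis is weaker; the gate's
  `dedup.landed` lint forbids public restatements), surfaced through §2's public `SU(N)` statements; the arithmetic of (53)
  summed is isolated as the public `lt_two_mul_of_ineq53`.  File 1's `AvgClosed` statements are the case `t = 1∕4`
  (`B7Prop2SpecialUnitary.avgClosedAt_of_avgClosed`; there `32(d+1)(d+4)L²α₀ ≤ 1∕32 ≤ 1∕4` follows from «`2α₀ ≤ c₂′`»,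
  `radius_le_of_hα2`).
* §2 `G = SU(N) ⊂ M_N(ℂ)` (operator norm (19), scope `Matrix.Norms.L2Operator`; `B7Prop2SpecialUnitary.specialUnitaryUnits`):
  **`regular_levels_specialUnitary`** — under b07's `N·(32(d+1)(d+4)L²α₀) < π` every `Ū₀ʲ`, `j ≤ k`, is `SU(N)`-valued,
  its plaquettes deviate from `1` by `< 2α₀(Lʲη)²`, its off-axis block loops by `≤ 1∕32`;
  **`regular_levels_specialUnitary_of_card_le`** — for `N ≤ 100` the `N`-dependent smallness is IMPLIED by «`2α₀ ≤ c₂′`»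
  (`32(d+1)(d+4)L²α₀ ≤ 1∕32`, `100∕32 < π`), so NE7c's certified instance `SU(2)` (and `SU(3)`) needs print's (52) +
  «`α₀ ≤ c₂`» ONLY; **`analyticOnNhd_Qtilde_level_specialUnitary`** ∕ **`norm_Qtilde_level_le_specialUnitary`** — the
  chart average at every `SU(N)`-valued averaged background, radius `1∕(2816(d+1)L)`, no regime binder.

WHAT THIS DOES NOT DO.  As file 1 (no `k`-uniform radius — rows S55∕S56; corner cubes on `ℤᵈ`; nothing of Bałaban's
minimisers); b07's counterexample side (`not_avgClosed_specialUnitary`, `N ≥ 26` at radius `1∕4`) is not re-derived, only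
cited by name here in prose; NE7c NOT proved; 0∕9 spine.
-/

noncomputable section

open NormedSpace Metric Set Finset

namespace Summit.QuantumFields.BalabanUV.T4Continuum.ShellMeasureAverageIterateRegularSUN

open Literature.MathematicalPhysics.QuantumFieldTheory.Balaban1983to89
open Literature.MathematicalPhysics.QuantumLattice (ZdEdge blockSites plaquetteHolonomyZd)
open B7BlockGeometry (qppBonds)
open B7Prop1Explicit (hol plaqWord boxVec Wcx U1)
open B7Prop2Explicit (avgIter pdev le_pdev pdev_nonneg C0 c2' C0_pos norm_Wcx_sub_one_le)
open B7Prop2SpecialUnitary (AvgClosedAt avgIter_mem_at ineq53_explicit_at specialUnitaryUnits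
  specialUnitaryUnits_le_unitaryUnits avgClosedAt_specialUnitary)
open B12HOperator267 (gammaT)
open B12AverageCorridor267 (loopW offAxis mem_blockSites_of_mem_offAxis Qtilde)
open B12PlaquetteLoop267 (exists_boxVec loopW_gammaT_eq_Wcx)
open ShellMeasureAverageAnalyticB7 (analyticOnNhd_Qtilde_gammaT norm_Qtilde_gammaT_le)
open ShellMeasureAverageIterateRegular (plaquetteHolonomyZd_uncurry)

variable {d : ℕ}

/-! ## §1 Proposition 2 in the b12 typing for a gauge group closed at radius `t` -/

section RegularAt

variable {𝔸 : Type*} [NormedRing 𝔸] [NormOneClass 𝔸] [NormedAlgebra ℂ 𝔸] [CompleteSpace 𝔸] {L : ℕ}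

omit [NormOneClass 𝔸] [NormedAlgebra ℂ 𝔸] [CompleteSpace 𝔸] in
/-- The arithmetic of (53) summed (file 1's `pdev_level_lt`, isolated): if `a < α₀t² + C₀(α₀t²)²·Σ_{i<j} ρⁱ` with
`Σ_{i<j} ρⁱ ≤ 2`, `0 ≤ t ≤ 1`, `0 < α₀`, `0 ≤ C₀`, `C₀α₀ ≤ ⅓`, then `a < 2α₀t²`. [folklore] -/
theorem lt_two_mul_of_ineq53 {a α₀ C t S : ℝ} (hα : 0 < α₀) (hC : 0 ≤ C) (hC3 : C * α₀ ≤ 1 / 3) (ht0 : 0 ≤ t)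
    (ht1 : t ≤ 1) (hS : S ≤ 2) (h : a < α₀ * t ^ 2 + C * (α₀ * t ^ 2) ^ 2 * S) : a < 2 * α₀ * t ^ 2 := by
  have ht2 : t ^ 2 ≤ 1 := pow_le_one₀ ht0 ht1
  have ha : 0 ≤ α₀ * t ^ 2 := by positivity
  have hat : α₀ * t ^ 2 ≤ α₀ := mul_le_of_le_one_right hα.le ht2
  have hCa : C * (α₀ * t ^ 2) ≤ 1 / 3 := (mul_le_mul_of_nonneg_left hat hC).trans hC3
  have hsq : 0 ≤ C * (α₀ * t ^ 2) ^ 2 := by positivity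
  have h1 : C * (α₀ * t ^ 2) ^ 2 * S ≤ C * (α₀ * t ^ 2) ^ 2 * 2 := mul_le_mul_of_nonneg_left hS hsq
  have h2 : α₀ * t ^ 2 + C * (α₀ * t ^ 2) ^ 2 * 2 = α₀ * t ^ 2 * (1 + 2 * (C * (α₀ * t ^ 2))) := by ring
  have h3 : α₀ * t ^ 2 * (1 + 2 * (C * (α₀ * t ^ 2))) ≤ α₀ * t ^ 2 * (1 + 2 * (1 / 3)) :=
    mul_le_mul_of_nonneg_left (by linarith) ha
  nlinarith

variable (hL : 2 ≤ L) {G : Subgroup 𝔸ˣ} {t : ℝ} (hG : AvgClosedAt d t L G) (k : ℕ) (U : ZdEdge d → 𝔸ˣ)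
  (hU : ∀ b, U b ∈ G) {α₀ : ℝ} (hα : 0 < α₀) (hα3 : C0 d * α₀ ≤ 1 / 3) (hα2 : 2 * α₀ ≤ c2' d L)
  (hαt : 32 * ((d : ℝ) + 1) * (d + 4) * (L : ℝ) ^ 2 * α₀ ≤ t)
  (h52 : pdev (Function.curry U) < α₀ * (((L : ℝ) ^ k)⁻¹) ^ 2)
include hL hG hU hα hα3 hα2 hαt h52

/-- Every averaged background `Ū₀ʲ`, `j ≤ k`, is `G`-valued, for `G` closed at radius `t ≥ 32(d+1)(d+4)L²α₀`
(`B7Prop2SpecialUnitary.avgIter_mem_at`). [cite: Balaban1985Averaging, (52)–(53) p.26] -/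
private theorem mem_level_at {j : ℕ} (hj : j ≤ k) (b : ZdEdge d) : Function.uncurry (avgIter L (Function.curry U) j) b ∈ G :=
  avgIter_mem_at L hL hG k (Function.curry U) (fun x κ => hU (x, κ)) hα hα3 hα2 hαt h52 j hj b.1 b.2

/-- **BINDER `hV` AT LEVEL `j ≤ k` (radius-`t` group):** `‖Ū₀ʲ(b)‖ ≤ 1`. [cite: Balaban1985Averaging, (19) p.21, (52)–(54) p.26] -/
private theorem norm_level_le_one_at {j : ℕ} (hj : j ≤ k) (b : ZdEdge d) :
    ‖((Function.uncurry (avgIter L (Function.curry U) j) b : 𝔸ˣ) : 𝔸)‖ ≤ 1 :=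
  (hG.le_U1 (mem_level_at hL hG k U hU hα hα3 hα2 hαt h52 hj b)).1

/-- **BINDER `hV′` AT LEVEL `j ≤ k` (radius-`t` group):** `‖Ū₀ʲ(b)⁻¹‖ ≤ 1`. [cite: Balaban1985Averaging, (19) p.21, (52)–(54) p.26] -/
private theorem norm_level_inv_le_one_at {j : ℕ} (hj : j ≤ k) (b : ZdEdge d) :
    ‖(((Function.uncurry (avgIter L (Function.curry U) j) b)⁻¹ : 𝔸ˣ) : 𝔸)‖ ≤ 1 :=
  (hG.le_U1 (mem_level_at hL hG k U hU hα hα3 hα2 hαt h52 hj b)).2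

/-- **(53) SUMMED (radius-`t` group): `pdev (avgIter j) < 2α₀(Lʲη)²`.** [cite: Balaban1985Averaging, (53) p.26] -/
private theorem pdev_level_lt_at {j : ℕ} (hj : j ≤ k) :
    pdev (avgIter L (Function.curry U) j) < 2 * α₀ * ((L : ℝ) ^ j * ((L : ℝ) ^ k)⁻¹) ^ 2 := by
  have hLr : (2 : ℝ) ≤ L := by exact_mod_cast hL
  have h53 := ineq53_explicit_at L hL hG k (Function.curry U) (fun x κ => hU (x, κ)) hα hα3 hα2 hαt h52 j hj
  have ht0 : 0 ≤ (L : ℝ) ^ j * ((L : ℝ) ^ k)⁻¹ := by positivity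
  have ht1 : (L : ℝ) ^ j * ((L : ℝ) ^ k)⁻¹ ≤ 1 := by
    rw [← div_eq_mul_inv, div_le_one (by positivity)]
    exact pow_le_pow_right₀ (by linarith) hj
  have hC0 : 0 ≤ C0 d * α₀ := by have := C0_pos d; positivity
  have hρ : (1 + C0 d * α₀) ^ 2 / (L : ℝ) ^ 2 ≤ 1 / 2 := (B7.prop2_ratio_lt_half (C0 d) α₀ L hLr hC0 hα3).le
  exact lt_two_mul_of_ineq53 hα (C0_pos d).le hα3 ht0 ht1 (B7.geom_bracket_le_two _ (by positivity) hρ j) h53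

/-- … hence `< 2α₀` at every level. [cite: Balaban1985Averaging, (54) p.26] -/
private theorem pdev_level_lt_two_alpha_at {j : ℕ} (hj : j ≤ k) : pdev (avgIter L (Function.curry U) j) < 2 * α₀ := by
  have hLr : (2 : ℝ) ≤ L := by exact_mod_cast hL
  have ht0 : 0 ≤ (L : ℝ) ^ j * ((L : ℝ) ^ k)⁻¹ := by positivity
  have ht1 : (L : ℝ) ^ j * ((L : ℝ) ^ k)⁻¹ ≤ 1 := by
    rw [← div_eq_mul_inv, div_le_one (by positivity)]
    exact pow_le_pow_right₀ (by linarith) hj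
  exact (pdev_level_lt_at hL hG k U hU hα hα3 hα2 hαt h52 hj).trans_le
    (mul_le_of_le_one_right (by positivity) (pow_le_one₀ ht0 ht1))

/-- **PLAQUETTE REGULARITY OF `Ū₀ʲ` (b12 form, radius-`t` group).** [cite: Balaban1985Averaging, (53)–(54) p.26] -/
private theorem plaquette_level_le_at {j : ℕ} (hj : j ≤ k) (x : Fin d → ℤ) (i i' : Fin d) :
    ‖((plaquetteHolonomyZd (Function.uncurry (avgIter L (Function.curry U) j)) x i i' : 𝔸ˣ) : 𝔸) - 1‖
      ≤ pdev (avgIter L (Function.curry U) j) := by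
  rw [plaquetteHolonomyZd_uncurry]
  exact le_pdev (fun y κ => hG.le_U1 (mem_level_at hL hG k U hU hα hα3 hα2 hαt h52 hj (y, κ))) x i i'

/-- **LOOP REGULARITY OF `Ū₀ʲ` (radius-`t` group):** `‖W_x(Ū₀ʲ) − 1‖ ≤ 16(d+1)(d+4)L²·pdev (avgIter j)` for every coarse
bond `c` and `x ∈ B(c₋)` (p. 25 via `B7Prop2Explicit.norm_Wcx_sub_one_le` + file 1's route). [cite: Balaban1985Averaging, p.25, (52)–(54) p.26] -/
private theorem loop_level_le_at {j : ℕ} (hj : j ≤ k) (c : ZdEdge d) {x : Fin d → ℤ} (hx : x ∈ blockSites L c.1) :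
    ‖((loopW L (fun U : ZdEdge d → 𝔸ˣ => gammaT L U) (Function.uncurry (avgIter L (Function.curry U) j)) c x : 𝔸ˣ) : 𝔸)
        - 1‖ ≤ 2 * (8 * (d + 1) * (d + 4) * (L : ℝ) ^ 2 * pdev (avgIter L (Function.curry U) j)) := by
  have hL0 : 0 < L := lt_of_lt_of_le (by norm_num) hL
  set W := avgIter L (Function.curry U) j with hW
  have hWU : ∀ y κ, W y κ ∈ U1 𝔸 := fun y κ => hG.le_U1 (mem_level_at hL hG k U hU hα hα3 hα2 hαt h52 hj (y, κ))
  have hP := pdev_level_lt_two_alpha_at hL hG k U hU hα hα3 hα2 hαt h52 hj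
  have hpos : (0 : ℝ) < 512 * ((d : ℝ) + 1) * (d + 4) * (L : ℝ) ^ 2 := by positivity
  have hsmall : 512 * (d + 1) * (d + 4) * (L : ℝ) ^ 2 * pdev W ≤ 1 := by
    have h1 : pdev W ≤ 1 / (512 * ((d : ℝ) + 1) * (d + 4) * (L : ℝ) ^ 2) := (hP.le.trans hα2).trans (le_of_eq rfl)
    rw [le_div_iff₀ hpos] at h1
    linarith
  obtain ⟨r, hr⟩ := exists_boxVec hx
  rw [loopW_gammaT_eq_Wcx hL0 _ c hx, Function.curry_uncurry, hr]
  exact norm_Wcx_sub_one_le L hL0 W hWU (pdev_nonneg W) hsmall (fun y κ κ' _ => le_pdev hWU y κ κ') _ c.2 r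

/-- **BINDER `hW` AT LEVEL `j ≤ k` WITH `ε = 1∕32` (radius-`t` group).** [cite: Balaban1985Averaging, p.25, (54) p.26] -/
private theorem loop_level_le_const_at {j : ℕ} (hj : j ≤ k) (c : ZdEdge d) {x : Fin d → ℤ} (hx : x ∈ offAxis L c) :
    ‖((loopW L (fun U : ZdEdge d → 𝔸ˣ => gammaT L U) (Function.uncurry (avgIter L (Function.curry U) j)) c x : 𝔸ˣ) : 𝔸)
        - 1‖ ≤ 1 / 32 := by
  have h := loop_level_le_at hL hG k U hU hα hα3 hα2 hαt h52 hj c (mem_blockSites_of_mem_offAxis hx)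
  have hP := pdev_level_lt_two_alpha_at hL hG k U hU hα hα3 hα2 hαt h52 hj
  have hpos : (0 : ℝ) < 512 * ((d : ℝ) + 1) * (d + 4) * (L : ℝ) ^ 2 := by positivity
  have hc : 2 * α₀ ≤ 1 / (512 * ((d : ℝ) + 1) * (d + 4) * (L : ℝ) ^ 2) := hα2.trans (le_of_eq rfl)
  rw [le_div_iff₀ hpos] at hc
  have hK : 0 ≤ 8 * ((d : ℝ) + 1) * (d + 4) * (L : ℝ) ^ 2 := by positivity
  refine h.trans ?_
  nlinarith [mul_le_mul_of_nonneg_left hP.le hK]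

/-- **THE THREE REGIME BINDERS AT LEVEL `j ≤ k` AT ONCE, radius-`t` group.** [cite: Balaban1985Averaging, Prop. 2 (52)–(54) p.26] -/
private theorem avgIter_regular_at {j : ℕ} (hj : j ≤ k) :
    (∀ b, Function.uncurry (avgIter L (Function.curry U) j) b ∈ G) ∧
      (∀ (x : Fin d → ℤ) (i i' : Fin d),
        ‖((plaquetteHolonomyZd (Function.uncurry (avgIter L (Function.curry U) j)) x i i' : 𝔸ˣ) : 𝔸) - 1‖
          < 2 * α₀ * ((L : ℝ) ^ j * ((L : ℝ) ^ k)⁻¹) ^ 2) ∧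
      ∀ (c : ZdEdge d), ∀ x ∈ offAxis L c,
        ‖((loopW L (fun U : ZdEdge d → 𝔸ˣ => gammaT L U) (Function.uncurry (avgIter L (Function.curry U) j)) c x : 𝔸ˣ)
            : 𝔸) - 1‖ ≤ 1 / 32 :=
  ⟨fun b => mem_level_at hL hG k U hU hα hα3 hα2 hαt h52 hj b,
    fun x i i' => (plaquette_level_le_at hL hG k U hU hα hα3 hα2 hαt h52 hj x i i').trans_lt
      (pdev_level_lt_at hL hG k U hU hα hα3 hα2 hαt h52 hj),
    fun c _ hx => loop_level_le_const_at hL hG k U hU hα hα3 hα2 hαt h52 hj c hx⟩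

/-- **The chart average at every level-`j` averaged background is analytic** on `ball 0 (1∕(2816(d+1)L))`, radius-`t` group,
no regime binder (S49 f2's `analyticOnNhd_Qtilde_gammaT` with §1's binders). [folklore] -/
private theorem analyticOnNhd_Qtilde_level_at {j : ℕ} (hj : j ≤ k) (c : ZdEdge d) :
    AnalyticOnNhd ℂ (fun B : ↥(qppBonds L c) → 𝔸 =>
        Qtilde L (fun U : ZdEdge d → 𝔸ˣ => gammaT L U) (Function.uncurry (avgIter L (Function.curry U) j))
          (Function.extend Subtype.val B (0 : ZdEdge d → 𝔸)) c)
      (ball 0 (1 / (2816 * ((d : ℝ) + 1) * L))) :=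
  analyticOnNhd_Qtilde_gammaT (lt_of_lt_of_le (by norm_num) hL) (norm_level_le_one_at hL hG k U hU hα hα3 hα2 hαt h52 hj)
    (norm_level_inv_le_one_at hL hG k U hU hα hα3 hα2 hαt h52 hj) (by norm_num : (0 : ℝ) ≤ 1 / 32)
    (by norm_num : (1 : ℝ) / 32 ≤ 1 / 8) (fun x hx => loop_level_le_const_at hL hG k U hU hα hα3 hα2 hαt h52 hj c hx)

/-- **… and bounded by `2816(d+1)L·‖B‖`** there. [folklore] -/
private theorem norm_Qtilde_level_le_at {j : ℕ} (hj : j ≤ k) (c : ZdEdge d) {B : ↥(qppBonds L c) → 𝔸}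
    (hB : ‖B‖ < 1 / (2816 * ((d : ℝ) + 1) * L)) :
    ‖Qtilde L (fun U : ZdEdge d → 𝔸ˣ => gammaT L U) (Function.uncurry (avgIter L (Function.curry U) j))
        (Function.extend Subtype.val B (0 : ZdEdge d → 𝔸)) c‖ ≤ 2816 * ((d : ℝ) + 1) * L * ‖B‖ :=
  norm_Qtilde_gammaT_le (lt_of_lt_of_le (by norm_num) hL) (norm_level_le_one_at hL hG k U hU hα hα3 hα2 hαt h52 hj)
    (norm_level_inv_le_one_at hL hG k U hU hα hα3 hα2 hαt h52 hj) (by norm_num : (0 : ℝ) ≤ 1 / 32)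
    (by norm_num : (1 : ℝ) / 32 ≤ 1 / 8) (fun x hx => loop_level_le_const_at hL hG k U hU hα hα3 hα2 hαt h52 hj c hx) hB

end RegularAt

/-! ## §2 The printed case `G = SU(N) ⊂ M_N(ℂ)` with the operator norm (19) -/

section SpecialUnitary

open scoped Matrix.Norms.L2Operator

variable {n : Type*} [Fintype n] [DecidableEq n] [Nonempty n] {L : ℕ}

/-- «`2α₀ ≤ c₂′`» makes b07's closure radius `32(d+1)(d+4)L²α₀` at most `1∕32` (`≤ 1∕4`). [folklore] -/
theorem radius_le_of_hα2 {d L : ℕ} {α₀ : ℝ} (hα2 : 2 * α₀ ≤ c2' d L) :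
    32 * ((d : ℝ) + 1) * (d + 4) * (L : ℝ) ^ 2 * α₀ ≤ 1 / 32 := by
  have hpos : (0 : ℝ) < 512 * ((d : ℝ) + 1) * (d + 4) * (L : ℝ) ^ 2 ∨
      512 * ((d : ℝ) + 1) * (d + 4) * (L : ℝ) ^ 2 = 0 := by
    rcases (show (0 : ℝ) ≤ 512 * ((d : ℝ) + 1) * (d + 4) * (L : ℝ) ^ 2 by positivity).lt_or_eq with h | h
    · exact Or.inl h
    · exact Or.inr h.symm
  rcases hpos with hpos | hzero
  · have h1 : 2 * α₀ ≤ 1 / (512 * ((d : ℝ) + 1) * (d + 4) * (L : ℝ) ^ 2) := hα2.trans (le_of_eq rfl)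
    rw [le_div_iff₀ hpos] at h1
    nlinarith
  · have hL0 : (L : ℝ) ^ 2 = 0 := by
      have h1 : (0 : ℝ) < 512 * ((d : ℝ) + 1) * (d + 4) := by positivity
      rcases mul_eq_zero.1 hzero with h | h
      · exact absurd h h1.ne'
      · exact h
    rw [hL0]; norm_num

/-- **[B7] PROP. 2 IN THE b12 TYPING FOR `SU(N)`-VALUED CONFIGURATIONS:** under print's (52) with «`α₀ ≤ c₂`» (`C₀α₀ ≤ ⅓`,
`2α₀ ≤ c₂′`) and b07's ONE `N`-dependent smallness `N·(32(d+1)(d+4)L²α₀) < π`, every averaged background `Ū₀ʲ`, `j ≤ k`,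
is `SU(N)`-VALUED, its plaquettes deviate from `1` by `< 2α₀(Lʲη)²`, its off-axis block loops by `≤ 1∕32`
(`B7Prop2SpecialUnitary.avgClosedAt_specialUnitary` + §1). [cite: Balaban1985Averaging, Prop. 2 (52)–(54) p.26, p.18, p.20] -/
theorem regular_levels_specialUnitary (hL : 2 ≤ L) (k : ℕ) (U : ZdEdge d → (Matrix n n ℂ)ˣ)
    (hU : ∀ b, U b ∈ specialUnitaryUnits n) {α₀ : ℝ} (hα : 0 < α₀) (hα3 : C0 d * α₀ ≤ 1 / 3)
    (hα2 : 2 * α₀ ≤ c2' d L) (hαN : Fintype.card n * (32 * ((d : ℝ) + 1) * (d + 4) * (L : ℝ) ^ 2 * α₀) < Real.pi)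
    (h52 : pdev (Function.curry U) < α₀ * (((L : ℝ) ^ k)⁻¹) ^ 2) {j : ℕ} (hj : j ≤ k) :
    (∀ b, Function.uncurry (avgIter L (Function.curry U) j) b ∈ specialUnitaryUnits n) ∧
      (∀ (x : Fin d → ℤ) (i i' : Fin d),
        ‖((plaquetteHolonomyZd (Function.uncurry (avgIter L (Function.curry U) j)) x i i' : (Matrix n n ℂ)ˣ)
            : Matrix n n ℂ) - 1‖ < 2 * α₀ * ((L : ℝ) ^ j * ((L : ℝ) ^ k)⁻¹) ^ 2) ∧
      ∀ (c : ZdEdge d), ∀ x ∈ offAxis L c,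
        ‖((loopW L (fun U : ZdEdge d → (Matrix n n ℂ)ˣ => gammaT L U)
            (Function.uncurry (avgIter L (Function.curry U) j)) c x : (Matrix n n ℂ)ˣ) : Matrix n n ℂ) - 1‖ ≤ 1 / 32 := by
  letI : CStarAlgebra (Matrix n n ℂ) := {}
  have ht4 : 32 * ((d : ℝ) + 1) * (d + 4) * (L : ℝ) ^ 2 * α₀ ≤ 1 / 4 := (radius_le_of_hα2 hα2).trans (by norm_num)
  exact avgIter_regular_at hL (avgClosedAt_specialUnitary d L ht4 hαN) k U hU hα hα3 hα2 le_rfl h52 hj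

/-- **… FOR `N ≤ 100` WITH NO `N`-DEPENDENT SMALLNESS** — NE7c's certified instance `SU(2)` (and `SU(3)`) included:
«`2α₀ ≤ c₂′`» gives the radius `≤ 1∕32` and `100∕32 < π`. [cite: Balaban1985Averaging, Prop. 2 (52)–(54) p.26] -/
theorem regular_levels_specialUnitary_of_card_le (hn : Fintype.card n ≤ 100) (hL : 2 ≤ L) (k : ℕ)
    (U : ZdEdge d → (Matrix n n ℂ)ˣ) (hU : ∀ b, U b ∈ specialUnitaryUnits n) {α₀ : ℝ} (hα : 0 < α₀)
    (hα3 : C0 d * α₀ ≤ 1 / 3) (hα2 : 2 * α₀ ≤ c2' d L)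
    (h52 : pdev (Function.curry U) < α₀ * (((L : ℝ) ^ k)⁻¹) ^ 2) {j : ℕ} (hj : j ≤ k) :
    (∀ b, Function.uncurry (avgIter L (Function.curry U) j) b ∈ specialUnitaryUnits n) ∧
      (∀ (x : Fin d → ℤ) (i i' : Fin d),
        ‖((plaquetteHolonomyZd (Function.uncurry (avgIter L (Function.curry U) j)) x i i' : (Matrix n n ℂ)ˣ)
            : Matrix n n ℂ) - 1‖ < 2 * α₀ * ((L : ℝ) ^ j * ((L : ℝ) ^ k)⁻¹) ^ 2) ∧
      ∀ (c : ZdEdge d), ∀ x ∈ offAxis L c,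
        ‖((loopW L (fun U : ZdEdge d → (Matrix n n ℂ)ˣ => gammaT L U)
            (Function.uncurry (avgIter L (Function.curry U) j)) c x : (Matrix n n ℂ)ˣ) : Matrix n n ℂ) - 1‖ ≤ 1 / 32 := by
  refine regular_levels_specialUnitary hL k U hU hα hα3 hα2 ?_ h52 hj
  have hr := radius_le_of_hα2 (d := d) (L := L) hα2
  have hn' : (Fintype.card n : ℝ) ≤ 100 := by exact_mod_cast hn
  have hπ : (3.14 : ℝ) < Real.pi := Real.pi_gt_d2
  have h0 : 0 ≤ 32 * ((d : ℝ) + 1) * (d + 4) * (L : ℝ) ^ 2 * α₀ := by positivity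
  calc (Fintype.card n : ℝ) * (32 * ((d : ℝ) + 1) * (d + 4) * (L : ℝ) ^ 2 * α₀) ≤ 100 * (1 / 32) :=
        mul_le_mul hn' hr h0 (by norm_num)
    _ < Real.pi := by linarith

/-- **The chart average at every `SU(N)`-valued averaged background `Ū₀ʲ`, `j ≤ k`, is analytic** on
`ball 0 (1∕(2816(d+1)L))` — print's (52) + «`α₀ ≤ c₂`» + b07's `N·32(d+1)(d+4)L²α₀ < π`, no regime binder. [folklore] -/
theorem analyticOnNhd_Qtilde_level_specialUnitary (hL : 2 ≤ L) (k : ℕ) (U : ZdEdge d → (Matrix n n ℂ)ˣ)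
    (hU : ∀ b, U b ∈ specialUnitaryUnits n) {α₀ : ℝ} (hα : 0 < α₀) (hα3 : C0 d * α₀ ≤ 1 / 3)
    (hα2 : 2 * α₀ ≤ c2' d L) (hαN : Fintype.card n * (32 * ((d : ℝ) + 1) * (d + 4) * (L : ℝ) ^ 2 * α₀) < Real.pi)
    (h52 : pdev (Function.curry U) < α₀ * (((L : ℝ) ^ k)⁻¹) ^ 2) {j : ℕ} (hj : j ≤ k) (c : ZdEdge d) :
    AnalyticOnNhd ℂ (fun B : ↥(qppBonds L c) → Matrix n n ℂ =>
        Qtilde L (fun U : ZdEdge d → (Matrix n n ℂ)ˣ => gammaT L U) (Function.uncurry (avgIter L (Function.curry U) j))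
          (Function.extend Subtype.val B (0 : ZdEdge d → Matrix n n ℂ)) c)
      (ball 0 (1 / (2816 * ((d : ℝ) + 1) * L))) := by
  letI : CStarAlgebra (Matrix n n ℂ) := {}
  have ht4 : 32 * ((d : ℝ) + 1) * (d + 4) * (L : ℝ) ^ 2 * α₀ ≤ 1 / 4 := (radius_le_of_hα2 hα2).trans (by norm_num)
  exact analyticOnNhd_Qtilde_level_at hL (avgClosedAt_specialUnitary d L ht4 hαN) k U hU hα hα3 hα2 le_rfl h52 hj c

/-- **… and bounded by `2816(d+1)L·‖B‖`** there. [folklore] -/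
theorem norm_Qtilde_level_le_specialUnitary (hL : 2 ≤ L) (k : ℕ) (U : ZdEdge d → (Matrix n n ℂ)ˣ)
    (hU : ∀ b, U b ∈ specialUnitaryUnits n) {α₀ : ℝ} (hα : 0 < α₀) (hα3 : C0 d * α₀ ≤ 1 / 3)
    (hα2 : 2 * α₀ ≤ c2' d L) (hαN : Fintype.card n * (32 * ((d : ℝ) + 1) * (d + 4) * (L : ℝ) ^ 2 * α₀) < Real.pi)
    (h52 : pdev (Function.curry U) < α₀ * (((L : ℝ) ^ k)⁻¹) ^ 2) {j : ℕ} (hj : j ≤ k) (c : ZdEdge d)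
    {B : ↥(qppBonds L c) → Matrix n n ℂ} (hB : ‖B‖ < 1 / (2816 * ((d : ℝ) + 1) * L)) :
    ‖Qtilde L (fun U : ZdEdge d → (Matrix n n ℂ)ˣ => gammaT L U) (Function.uncurry (avgIter L (Function.curry U) j))
        (Function.extend Subtype.val B (0 : ZdEdge d → Matrix n n ℂ)) c‖ ≤ 2816 * ((d : ℝ) + 1) * L * ‖B‖ := by
  letI : CStarAlgebra (Matrix n n ℂ) := {}
  have ht4 : 32 * ((d : ℝ) + 1) * (d + 4) * (L : ℝ) ^ 2 * α₀ ≤ 1 / 4 := (radius_le_of_hα2 hα2).trans (by norm_num)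
  exact norm_Qtilde_level_le_at hL (avgClosedAt_specialUnitary d L ht4 hαN) k U hU hα hα3 hα2 le_rfl h52 hj c hB

end SpecialUnitary

end Summit.QuantumFields.BalabanUV.T4Continuum.ShellMeasureAverageIterateRegularSUN

end
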